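import Mathlib
import Summits.QuantumFields.BalabanUV.Beta.CovariantPlateauBlocksEnd

/-!
# Beta / CovariantPlateauBlocksGauge — THE GENERAL-U MODEL INSTANCE OF E-I3, PART 3: the END for ANY bound `H` on the
# in-block holonomy defect, the (3.35)-LITERAL form («there exists a gauge transformation u on □ such that …»: a gauge
# `g_y` on every block making its in-block bond transporters ε-close to `1` ⟹ `h ≤ (2ν(n−1) + 1)·ε`, by p222209's gauge
# form of the thin-loop bound), and the TORUS reading (blocks `(ℤ∕m)^ν` glued cyclically)
# (unit `b2b-balaban-beta-d4-p2`, GEN 6, MODEL crew; claim «E-I3-COV-MODEL» journal l.15376; parts 1–2 = p222441, p222705)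

HONEST FRAMING: discharging `BetaPertH` makes Bałaban's UV stability UNCONDITIONAL — NOT the continuum limit, NOT the
Clay problem.  HONEST DEPENDENCY (verbatim): «continuum YM on T⁴ ⇐ BetaPertH ∧ nine spine estimates (0/9 proved);
BetaPertH ⇐ (D1) ∧ (D4) ∧ CAP+tail; G-an2-4 gates asym, D1 and NE2/3/4.»  THIS MODULE DISCHARGES NOTHING of `BetaPertH`,
asserts NOTHING printed and cites nothing as a fact (ABSOLUTE RULE): [folklore] about a MODEL (cubic blocks, any gluing,
in-block product plateaus, tree contours, orthogonal transporters and block gauges as DATA); nothing of Bałaban's operators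
instantiated; which `W`, which gauge, which `ε` ((3.35): `ε ~ O(1)Mα₀·L^{−j}` on a cube of index `j`) is NODE O.2's business.
SHAPES located at [B9] = `Balaban1985BackgroundPropagators` (3.35) p. 396 («for an arbitrary cube □ … there exists a gauge
transformation u on □ such that Uᵘ = e^{iηA}, and if the index of □ is j, then |A| < O(1)Mα₀(L^jη)^{−1} …»), (3.19) p. 393;
[B6] = `Balaban1984PropagatorsII` (2.76) p. 236.  No class change on row D4 or G-B9-15 (width 0; D4 DISCHARGE NO DATE); NOT
BetaPertH, NOT continuum, NOT Clay, NOT summit progress.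

CONTENT (kernel, 0 sorry).  §1 **`coarse_coercive_plateau_blocks_of_hdef`**: the END of part 2 for ANY `H ≥ 0` bounding
`hdef` on in-block bonds (the plaquette END p222705 is the case `H = ν(n−1)α`).  §2 the gauge form: bonds of the box read
back as in-block bonds (`exists_off_of_bondIn`), the block gauge read on `ℤ^ν` (`gaugeCfg`), **`hdef_le_of_gauge`**
(`h ≤ (2ν(n−1) + 1)·ε`), END **`coarse_coercive_plateau_blocks_gauge`**.  §3 the torus: `torusGlue` on `(ℤ∕m)^ν`,
**`coarse_coercive_plateau_torus`**.  §4 non-vacuity.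
-/

namespace Summit.QuantumFields.BalabanUV.Beta.CovariantPlateauBlocksGauge

open scoped BigOperators Matrix Matrix.Norms.L2Operator
open Finset
open Literature.MathematicalPhysics.QuantumFieldTheory.Balaban1983to89.B5Prop11Lower (nsq nsq_nonneg)
open Literature.MathematicalPhysics.QuantumFieldTheory.Balaban1983to89.B7Prop1Explicit (Site e e_apply l1 gaugeAct U1)
open Literature.MathematicalPhysics.QuantumFieldTheory.Balaban1983to89.B7Prop1Local (InBox)
open Summit.QuantumFields.BalabanUV.Beta.AccretiveCombesThomasSandwich (sandwich)
open Summit.QuantumFields.BalabanUV.Beta.CoarseCoerciveTransport (covFamily)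
open Summit.QuantumFields.BalabanUV.Beta.CoarseCoerciveCovariantEnergy (covDiff coarse_coercive_cov)
open Summit.QuantumFields.BalabanUV.Beta.CoarseCoerciveBlock1D (gramForm gramForm_isHermitian isUnit_gramForm
  re_form_gramForm re_form_gramForm_nonneg)
open Summit.QuantumFields.BalabanUV.Beta.ThinLoopHolonomy
open Summit.QuantumFields.BalabanUV.Beta.CovariantPlateauBlocks
open Summit.QuantumFields.BalabanUV.Beta.CovariantPlateauBlocksEnd

noncomputable section

variable {Y : Type*} [Fintype Y] [DecidableEq Y] {Cp : Type*} [Fintype Cp] [DecidableEq Cp] {ν n w : ℕ} [NeZero n]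
variable (W : Bond Y ν n → Matrix Cp Cp ℝ) (hW : ∀ b, (W b)ᵀ * W b = 1)

/-! ## §1 The END for any bound on the in-block holonomy defect -/

/-- **E-I3, MODEL INSTANCE, FOR ANY DEFECT BOUND**: if `hdef ≤ H` (`H ≥ 0`) on every in-block bond, then
`(((n−2w)/n)^ν)² / (μ₀·n^ν + (1/w + H)·(ν n^ν (1/w + H))) · ‖B‖² ≤ Re B*(Q̃_W A_W⁻¹ Q̃_Wᵀ)B` — owner's `coarse_coercive_cov`
with this unit's counting. [cite: Balaban1985BackgroundPropagators, (3.19) p.393] -/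
theorem coarse_coercive_plateau_blocks_of_hdef (σ : Fin ν → Y → Y) (hw : 0 < w) (h2w : 2 * w < n) {μ0 : ℝ}
    (hμ0 : 0 < μ0) {H : ℝ} (hH0 : 0 ≤ H) (hH : ∀ b : Bond Y ν n, (b.1.2 b.2 : ℕ) + 1 < n → ∀ y, hdef W hW σ b y ≤ H)
    (B : Y × Cp → ℂ) :
    ((((n : ℝ) - 2 * w) / n) ^ ν) ^ 2 / (μ0 * (1 * (n : ℝ) ^ ν) + (1 / w + H) * (ν * (n : ℝ) ^ ν * (1 / w + H))) * nsq B ≤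
      (star B ⬝ᵥ (sandwich (gramForm μ0 (covDiff bsrc (btgt σ) W)) (covFamily sB (Rfam W hW)) *ᵥ B)).re := by
  have hn : (0 : ℝ) < n := by exact_mod_cast Nat.pos_of_ne_zero (NeZero.ne n)
  have hδ0 : 0 < (((n : ℝ) - 2 * w) / n) ^ ν := by
    have : (0 : ℝ) < (n : ℝ) - 2 * w := by
      have : (2 * w : ℝ) < n := by exact_mod_cast h2w
      linarith
    positivity
  have hθ0 : (0 : ℝ) ≤ 1 / w + H := by positivity
  have hE : 0 < μ0 * (1 * (n : ℝ) ^ ν) + (1 / w + H) * (ν * (n : ℝ) ^ ν * (1 / w + H)) := by positivity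
  exact coarse_coercive_cov (gramForm μ0 (covDiff bsrc (btgt σ) W)) (gramForm_isHermitian _ _) (isUnit_gramForm hμ0 _)
    (re_form_gramForm_nonneg hμ0.le _) bsrc (btgt σ) W hμ0.le (fun z => (re_form_gramForm μ0 _ z).le) (tB w) sB
    (fun y y' x h => tB_mul_sB_eq_zero y y' x h) (Rfam W hW) (fun _ x => Rtr_mul_transpose W hW x) hW hδ0
    (mass_ge hw h2w.le) (hdef W hW σ) (hdef_nonneg W hW σ) (hhol_hdef W hW σ) zero_le_one (sum_abs_tB_site_le hw)
    (sum_abs_tB_block_le hw) hθ0 (row_le W hW σ hw hH0 hH) (col_le W hW σ hw hH0 hH) hE B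

/-! ## §2 The (3.35)-literal form: a small gauge on every block -/

/-- A genuine bond of the box `[0, n−1]^ν` is an in-block bond: `x = emb v`, `x + e_κ = emb (v + e_κ)`, `v κ + 1 < n`. [folklore] -/
theorem exists_off_of_bondIn {x : Site ν} {κ : Fin ν} (hx : InBox 0 (boxHi ν n) x) (hxe : InBox 0 (boxHi ν n) (x + e κ)) :
    ∃ (v : Off ν n) (h : (v κ : ℕ) + 1 < n), emb v = x ∧ emb (succOff v κ h) = x + e κ := by
  have hk := (hxe κ).2
  have hz := (hx κ).1
  simp only [boxHi, Pi.add_apply, e_apply, Pi.zero_apply] at hk hz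
  simp only [if_true] at hk
  have hv : ((toOff (n := n) x) κ : ℕ) + 1 < n := by
    simp only [toOff]
    have hn := Nat.pos_of_ne_zero (NeZero.ne n)
    have : (x κ).toNat < n - 1 := by omega
    rw [Nat.mod_eq_of_lt (by omega)]
    omega
  exact ⟨toOff x, hv, emb_toOff hx, by rw [emb_succOff, emb_toOff hx]⟩

/-- The block gauge read on `ℤ^ν` (complexified, as norm-≤-1 units). [folklore] -/
def gaugeCfg (g : Y → Off ν n → Matrix Cp Cp ℝ) (hg : ∀ y v, (g y v)ᵀ * g y v = 1) (y : Y) : Site ν → (Matrix Cp Cp ℂ)ˣ :=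
  fun z => cpxUnit (g y (toOff z)) (hg y _)

omit [Fintype Y] [DecidableEq Y] in
/-- Its values are norm-≤-1 units. [folklore] -/
theorem gaugeCfg_mem [Nonempty Cp] (g : Y → Off ν n → Matrix Cp Cp ℝ) (hg : ∀ y v, (g y v)ᵀ * g y v = 1) (y : Y)
    (z : Site ν) : gaugeCfg g hg y z ∈ U1 (Matrix Cp Cp ℂ) := cpxUnit_mem_U1 _ _

omit [Fintype Y] [DecidableEq Y] in
/-- The block gauge at an embedded offset. [folklore] -/
theorem val_gaugeCfg_emb (g : Y → Off ν n → Matrix Cp Cp ℝ) (hg : ∀ y v, (g y v)ᵀ * g y v = 1) (y : Y) (v : Off ν n) :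
    ((gaugeCfg g hg y (emb v) : (Matrix Cp Cp ℂ)ˣ) : Matrix Cp Cp ℂ) = cpxHom (g y v) := by
  show cpxHom (g y (toOff (emb v))) = _
  rw [toOff_emb]

omit [Fintype Y] [DecidableEq Y] in
/-- … and its inverse (the transpose). [folklore] -/
theorem val_inv_gaugeCfg_emb (g : Y → Off ν n → Matrix Cp Cp ℝ) (hg : ∀ y v, (g y v)ᵀ * g y v = 1) (y : Y)
    (v : Off ν n) : (((gaugeCfg g hg y (emb v))⁻¹ : (Matrix Cp Cp ℂ)ˣ) : Matrix Cp Cp ℂ) = cpxHom (g y v)ᵀ := by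
  show cpxHom (g y (toOff (emb v)))ᵀ = _
  rw [toOff_emb]

omit [Fintype Y] [DecidableEq Y] in
/-- The complexified block field at an embedded offset. [folklore] -/
theorem val_cpxCfg_emb (y : Y) (v : Off ν n) (κ : Fin ν) :
    ((cpxCfg W hW y (emb v) κ : (Matrix Cp Cp ℂ)ˣ) : Matrix Cp Cp ℂ) = cpxHom (W ((y, v), κ)) := by
  show cpxHom (W ((y, toOff (emb v)), κ)) = _
  rw [toOff_emb]

omit [Fintype Y] [DecidableEq Y] in
/-- The gauged bond variable on a genuine box bond, unfolded: `cpx(g(v)·W((y,v),κ)·g(v+e_κ)ᵀ)`. [folklore] -/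
theorem val_gaugeAct_gaugeCfg (g : Y → Off ν n → Matrix Cp Cp ℝ) (hg : ∀ y v, (g y v)ᵀ * g y v = 1) (y : Y)
    (v : Off ν n) (κ : Fin ν) (h : (v κ : ℕ) + 1 < n) :
    ((gaugeAct (gaugeCfg g hg y) (cpxCfg W hW y) (emb v) κ : (Matrix Cp Cp ℂ)ˣ) : Matrix Cp Cp ℂ) =
      cpxHom (g y v * W ((y, v), κ) * (g y (succOff v κ h))ᵀ) := by
  rw [gaugeAct, Units.val_mul, Units.val_mul, ← emb_succOff v κ h, val_gaugeCfg_emb, val_cpxCfg_emb,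
    val_inv_gaugeCfg_emb, ← map_mul, ← map_mul]

omit [Fintype Y] [DecidableEq Y] in
/-- **THE FIELD INPUT SUPPLIED (gauge form = (3.35) as printed)**: if on every block `y` some orthogonal gauge `g_y` makes
every IN-BLOCK bond transporter ε-close to `1` — `‖cpx(g_y(v)·W((y,v),κ)·g_y(v+e_κ)ᵀ) − 1‖ ≤ ε` — then the holonomy defect
of every in-block bond is at most `(2ν(n−1) + 1)·ε` (the thin loop is a product of that many gauged bond variables; its
defect is gauge invariant). [cite: Balaban1985BackgroundPropagators, (3.35) p.396] -/
theorem hdef_le_of_gauge [Nonempty Cp] (g : Y → Off ν n → Matrix Cp Cp ℝ) (hg : ∀ y v, (g y v)ᵀ * g y v = 1)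
    (σ : Fin ν → Y → Y) {ε : ℝ} (hε : 0 ≤ ε)
    (h335 : ∀ (y : Y) (v : Off ν n) (κ : Fin ν) (h : (v κ : ℕ) + 1 < n),
      ‖cpxHom (g y v * W ((y, v), κ) * (g y (succOff v κ h))ᵀ) - 1‖ ≤ ε)
    {b : Bond Y ν n} (hb : (b.1.2 b.2 : ℕ) + 1 < n) (y : Y) :
    hdef W hW σ b y ≤ (2 * (ν * ((n : ℝ) - 1)) + 1) * ε := by
  have hn1 : ∀ i, (0 : Site ν) i ≤ boxHi ν n i := fun i => by
    have := Nat.pos_of_ne_zero (NeZero.ne n)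
    simp only [boxHi, Pi.zero_apply]; omega
  have hG := norm_thinLoop_sub_one_le_of_gauge hn1 (cpxCfg W hW b.1.1) (cpxCfg_mem W hW b.1.1)
    (gaugeCfg_mem g hg b.1.1) hε
    (fun x κ hx hxe => by
      obtain ⟨v, h, rfl, _⟩ := exists_off_of_bondIn hx hxe
      rw [val_gaugeAct_gaugeCfg W hW g hg b.1.1 v κ h]
      exact h335 b.1.1 v κ h)
    (y := 0) (x := emb b.1.2) (μ := b.2) (fun i => ⟨le_rfl, hn1 i⟩) (emb_inBox _)
    (by rw [← emb_succOff b.1.2 b.2 hb]; exact emb_inBox _)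
  rw [sub_zero, ← emb_succOff b.1.2 b.2 hb, sub_zero] at hG
  have h1 := l1_emb_le b.1.2
  have h2 := l1_emb_le (succOff b.1.2 b.2 hb)
  calc hdef W hW σ b y ≤ _ := hdef_le_norm_thinLoop W hW σ hb y
    _ ≤ ((l1 (emb b.1.2) : ℝ) + 1 + l1 (emb (succOff b.1.2 b.2 hb))) * ε := by exact_mod_cast hG
    _ ≤ (2 * (ν * ((n : ℝ) - 1)) + 1) * ε := by
        refine mul_le_mul_of_nonneg_right ?_ hε
        linarith

/-- **E-I3, MODEL INSTANCE, (3.35)-LITERAL FORM**: for every orthogonal transport field `W` admitting on each block a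
gauge in which its in-block bond transporters are ε-close to `1`, with `H = (2ν(n−1) + 1)·ε`:
`(((n−2w)/n)^ν)² / (μ₀·n^ν + (1/w + H)·(ν n^ν (1/w + H))) · ‖B‖² ≤ Re B*(Q̃_W A_W⁻¹ Q̃_Wᵀ)B`.
[cite: Balaban1985BackgroundPropagators, (3.35) p.396] -/
theorem coarse_coercive_plateau_blocks_gauge [Nonempty Cp] (g : Y → Off ν n → Matrix Cp Cp ℝ)
    (hg : ∀ y v, (g y v)ᵀ * g y v = 1) (σ : Fin ν → Y → Y) (hw : 0 < w) (h2w : 2 * w < n) {μ0 : ℝ} (hμ0 : 0 < μ0)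
    {ε : ℝ} (hε : 0 ≤ ε)
    (h335 : ∀ (y : Y) (v : Off ν n) (κ : Fin ν) (h : (v κ : ℕ) + 1 < n),
      ‖cpxHom (g y v * W ((y, v), κ) * (g y (succOff v κ h))ᵀ) - 1‖ ≤ ε) (B : Y × Cp → ℂ) :
    ((((n : ℝ) - 2 * w) / n) ^ ν) ^ 2 / (μ0 * (1 * (n : ℝ) ^ ν) +
        (1 / w + (2 * (ν * ((n : ℝ) - 1)) + 1) * ε) * (ν * (n : ℝ) ^ ν * (1 / w + (2 * (ν * ((n : ℝ) - 1)) + 1) * ε))) *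
      nsq B ≤ (star B ⬝ᵥ (sandwich (gramForm μ0 (covDiff bsrc (btgt σ) W)) (covFamily sB (Rfam W hW)) *ᵥ B)).re := by
  have hH0 : 0 ≤ (2 * (ν * ((n : ℝ) - 1)) + 1) * ε := by
    have : (1 : ℝ) ≤ n := by exact_mod_cast Nat.pos_of_ne_zero (NeZero.ne n)
    have : 0 ≤ (n : ℝ) - 1 := by linarith
    positivity
  exact coarse_coercive_plateau_blocks_of_hdef W hW σ hw h2w hμ0 hH0
    (fun b hb y => hdef_le_of_gauge W hW g hg σ hε h335 hb y) B

/-! ## §3 The torus reading: blocks `(ℤ∕m)^ν` glued cyclically -/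

/-- The cyclic gluing of the blocks of the torus `(ℤ∕m)^ν × (Fin n)^ν ≅ (ℤ∕(mn))^ν`: across the face in direction `i` one
enters block `y + e_i`. [folklore] -/
def torusGlue (ν m : ℕ) (i : Fin ν) (y : Fin ν → ZMod m) : Fin ν → ZMod m := Function.update y i (y i + 1)

/-- **E-I3 ON THE TORUS, GENERAL BACKGROUND (MODEL)**: the plaquette-form END of p222705 on `(ℤ∕m)^ν` blocks of side `n`
glued cyclically (the carrier of this unit's gen-5 U = 1 tents up to `(ℤ∕m × Fin n)^ν ≅ (ℤ∕m)^ν × (Fin n)^ν`), every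
orthogonal transport field with in-block plaquettes within `α` of `1`. [cite: Balaban1985BackgroundPropagators, (3.19) p.393, (3.35) p.396] -/
theorem coarse_coercive_plateau_torus [Nonempty Cp] {m : ℕ} [NeZero m] (W : Bond (Fin ν → ZMod m) ν n → Matrix Cp Cp ℝ)
    (hW : ∀ b, (W b)ᵀ * W b = 1) (hw : 0 < w) (h2w : 2 * w < n) {μ0 : ℝ} (hμ0 : 0 < μ0) {α : ℝ} (hα : 0 ≤ α)
    (hplaqW : ∀ (y : Fin ν → ZMod m) (v : Off ν n) (κ μ : Fin ν) (hκ : (v κ : ℕ) + 1 < n) (hμ : (v μ : ℕ) + 1 < n),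
      κ ≠ μ → ‖cpxHom (plaqW W y v κ μ hκ hμ) - 1‖ ≤ α) (B : (Fin ν → ZMod m) × Cp → ℂ) :
    ((((n : ℝ) - 2 * w) / n) ^ ν) ^ 2 /
        (μ0 * (1 * (n : ℝ) ^ ν) + (1 / w + ν * ((n : ℝ) - 1) * α) * (ν * (n : ℝ) ^ ν * (1 / w + ν * ((n : ℝ) - 1) * α))) *
      nsq B ≤ (star B ⬝ᵥ (sandwich (gramForm μ0 (covDiff bsrc (btgt (torusGlue ν m)) W))
        (covFamily sB (Rfam W hW)) *ᵥ B)).re :=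
  coarse_coercive_plateau_blocks W hW (torusGlue ν m) hw h2w hμ0 hα hplaqW B

/-! ## §4 Non-vacuity -/

/-- The flat field with the trivial gauge on one block of side 3 (`ν = 1`, `w = 1`, fibre `Unit`, `μ₀ = 1`, `ε = 0`): the
gauge-form END gives the explicit positive constant `1/54`. [folklore] -/
example (B : Unit × Unit → ℂ) :
    (1 / 54 : ℝ) * nsq B ≤
      (star B ⬝ᵥ (sandwich (gramForm 1 (covDiff bsrc (btgt (fun (_ : Fin 1) (_ : Unit) => ()))
          fun _ : Bond Unit 1 3 => (1 : Matrix Unit Unit ℝ)))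
        (covFamily (sB (Y := Unit) (ν := 1) (n := 3)) (Rfam (fun _ : Bond Unit 1 3 => (1 : Matrix Unit Unit ℝ)) flat_orth))
          *ᵥ B)).re := by
  have h := coarse_coercive_plateau_blocks_gauge (Y := Unit) (Cp := Unit) (ν := 1) (n := 3) (w := 1) (μ0 := 1) (ε := 0)
    (fun _ : Bond Unit 1 3 => (1 : Matrix Unit Unit ℝ)) flat_orth (fun _ _ => (1 : Matrix Unit Unit ℝ)) (fun _ _ => by simp)
    (fun (_ : Fin 1) (_ : Unit) => ()) Nat.one_pos (by norm_num) one_pos le_rfl (fun y v κ h => by simp) B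
  convert h using 2
  norm_num

end

end Summit.QuantumFields.BalabanUV.Beta.CovariantPlateauBlocksGauge
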